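import Literature.MathematicalPhysics.QuantumFieldTheory.AoyamaEtAl2006.UVLimitRemainders
import HarnessLib

/-!
# The merged denominators of the I-operation agree with `U`, `V` to the next order along the IR limit: `U − U_S U_R = O(δ^{2n_S+1})` and `V − V_S − V_R = O(δ³)`, i.e. `(UV)_G U_S U_R − (UV)_S U_G U_R − (UV)_R U_G U_S = O(δ^{4 n_S + 3})` on the mass shell (AHKN 2008 §3 I-operation «U → U_S U_R, V → V_S + V_R» with Cvitanović–Kinoshita 1974 II (4.24), (4.30)) — PROVED in the loop-matrix form

independent recomputation; certified where stated, statistical where stated; no new-physics claim.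

HONEST FRAMING (venture `QEDPrecision`, cell `qed-hepp`, seat `qed-hepp-lit` gen 4; VALUE-FREE: divisibility statements between polynomial
expressions in the entries of arbitrary integer matrices and arbitrary parameters of a commutative ring — no graph, no integral, no number of any
Set-V family). Purpose: the IR companion of `AoyamaEtAl2006.UVLimitRemainders`. The cell's theory seat reduces its last analytic gap on the IR side
(HOME/theory/BOUNDEDNESS.md §5.10 «GAP-IRB at κ0», §6.3 RULE R-KI, §14) to AHKN-II's construction: along the IR limit of a self-energy subdiagram `S`
the I-subtraction term, built with the MERGED denominators `U_S U_R` and `V_S + V_R` on `M_G`'s own parameter domain, has the same leading behaviour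
as `M_G`, so that bare and subtraction pieces cancel at leading order and the group gains one power of the IR scale. `SubdiagramIRLimits` proved the
DENOMINATOR half as equalities of leading coefficients (C-K II (4.24) `[U]_IR = U_S [U_R]_IR`, (4.30) `[V]_IR = V_S + [V_R]_IR`); this file proves the
same half in the REMAINDER form the seat's degree bookkeeping uses (as `UVLimitRemainders` did for GAP-RK): the differences are divisible by one more
power of the IR scale `λ` (= δ), for an arbitrary `S`-adapted loop matrix.

SOURCES, AS PRINTED.
* [AoyamaHayakawaKinoshitaNio2008] T. Aoyama, M. Hayakawa, T. Kinoshita, M. Nio, Nucl. Phys. B 796 (2008) 184 = arXiv:0709.1568, §3 (`lit read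
  paper:arxiv-0709.1568`, chunk p0007:L52–L95): «the IR divergence is caused by vanishing of the denominator function V … in the corner of the
  integration domain characterized by z_i = O(δ) if i is an lepton line in R, z_i = O(1) if i is a photon line in R, z_i = O(ε), ε ∼ δ² if i ∈ S
  (irlimit), where R = G/S. In this limit the denominator V vanishes as O(δ²). … For the subdiagram R = G/S the I-operation I_R is defined as follows:
  In the limit (irlimit) keep only terms with lowest power of ε and δ in U, B_ij, A_i. Make the following replacements: U → U_S U_R, V → V_S + V_R,
  F → F_0[L_R] F_S … This procedure creates an integral defined on the parametric space of M_G.»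
* [CvitanovicKinoshita1974b] P. Cvitanović, T. Kinoshita, Phys. Rev. D 10 (1974) 3991, §IV B p. 4002–4003: «let us define the IR limit [f]^{G/S}_IR
  of an arbitrary parametric function f(z_i) as the leading term in the double expansion in δ, ε», (4.24) «[U]^{G/S}_IR = U^S [U^{G/S}]_IR», (4.30)
  «[V]^{G/S}_IR = V_S + [V_{G/S}]_IR» (typed: `SubdiagramIRLimits.irU_zero`, `irG_zero`, `V_ir_leading`).

TYPING. As in `SubdiagramIRLimits`: `S`-adapted blocks `TI, TOS, TOO`, inner circuits `κI` (`n_S = |κI| ≥ 1`), lines of `S` `μS` (parameters `zS`),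
soft outer lines `μE` (leptons of `R`, `zE`), hard outer lines `μH` (photons of `R`, `zH`); the IR point at scale `λ` is `irZ λ = (λ² zS, λ zE, zH)`;
the three polynomials are functions of the SAME parameter vector, so `U_S`, `(UV)_S` are evaluated at `λ² zS` and `U_R`, `(UV)_R` at `(λ zE, zH)`
(= `outerZ zE zH λ`) — NOT at their `λ = 0` limits: the I-term is an exact function on `M_G`'s domain. «`f = O(λ^k)`» is typed as `λ^k ∣ f` for
an arbitrary ring element `λ`. The `V`-statement is on the MASS SHELL (`VNum_onShell`: `U·V = m² · wᵀadj(U_st) w`), the only case in which `V`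
vanishes in the IR limit; the quadratic-form version `irGNUM_dvd` needs no mass-shell hypothesis.
PROVED (0 named facts). Naturality `UMat_map`; reduction modulo `λ` under any ring map `π` with `π λ = 0`: `map_outerZ`, `map_UDet_outer`,
`map_irU`, `map_irG`, `map_outerG` (each `π f(λ) = π f(0)`). **`irRU_dvd`: `λ^{2 n_S + 1} ∣ U_G(irZ λ) − U_S(λ² zS) · U_R(λ zE, zH)`** («U → U_S U_R» keeps
the lowest power: the remainder is one order higher). `irGNUM` := `G_G·U_S U_R − G_S·U_G U_R − G_R·U_G U_S` along the ray (`G = wᵀ adj(U_st) w`),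
`irGNUM_eq` (`= λ^{4n_S+2} · irgCof(λ)`), `irgCof_zero` (the leading coefficient CANCELS by (4.24) + (4.30)), **`irGNUM_dvd`: `λ^{4 n_S + 3} ∣ irGNUM`**;
`irDNUM` := `(UV)_G·U_S U_R − (UV)_S·U_G U_R − (UV)_R·U_G U_S` along the ray, `irDNUM_onShell` (`= m² · irGNUM`), **`irDNUM_dvd`** (on shell): i.e.
`V_G − V_S − V_R = irDNUM/(U_G U_S U_R)` is `O(λ³)` against `V_G = O(λ²)` — «V → V_S + V_R» keeps the lowest power.
NOT CLAIMED: the numerator replacement `F → F_0[L_R] F_S` and the letter bookkeeping (BOUNDEDNESS.md §5.10 (a), (c)); exactness of the orders; the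
graph dictionary (see `AoyamaEtAl2006.QTypeLoopMatrix`); anything about the cell's integrands.
-/

namespace Literature.MathematicalPhysics.QuantumFieldTheory.AoyamaHayakawaKinoshitaNio2008

open Matrix Finset
open Literature.MathematicalPhysics.QuantumFieldTheory.AoyamaEtAl2006
open Literature.MathematicalPhysics.QuantumFieldTheory.CvitanovicKinoshita1974

/-! ## Reduction modulo the IR scale `λ` -/

section ModLam

variable {R : Type*} [CommRing R] {R' : Type*} [CommRing R']

/-- Naturality of `U_st`: a ring map acts on the parameters. [cite: AoyamaEtAl2006, §2.3 (eq. for U_st)] -/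
theorem UMat_map {κ μ : Type*} [Fintype μ] (T : Matrix κ μ ℤ) (z : μ → R) (π : R →+* R') : (UMat T z).map π = UMat T (π ∘ z) := by
  ext s t
  simp [UMat, map_sum]

variable {κI κO μS μE μH : Type*} [Fintype κI] [Fintype κO] [Fintype μS] [Fintype μE] [Fintype μH] [DecidableEq κI] [DecidableEq κO]
variable (TI : Matrix κI μS ℤ) (TOS : Matrix κO μS ℤ) (TOO : Matrix κO (μE ⊕ μH) ℤ)
  (zS : μS → R) (zE : μE → R) (zH : μH → R) (χS : μS → R) (χE : μE → R)

omit [Fintype μE] [Fintype μH] in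
/-- The outer parameters `(λ zE, zH) ≡ (0, zH) (mod λ)`. [cite: AoyamaHayakawaKinoshitaNio2008, §3 eq. (irlimit)] -/
theorem map_outerZ (π : R →+* R') {lam : R} (hl : π lam = 0) : π ∘ outerZ zE zH lam = π ∘ outerZ zE zH 0 := by
  funext c
  rcases c with e | h
  · simp [outerZ, hl]
  · simp [outerZ]

omit [Fintype κO] [DecidableEq κO] in
/-- `U^R_st(λ zE, zH) ≡ U^R_st(0, zH) (mod λ)`, entrywise. [cite: CvitanovicKinoshita1974b, §IV eq. (4.9)] -/
theorem map_UMat_outer (π : R →+* R') {lam : R} (hl : π lam = 0) :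
    (UMat TOO (outerZ zE zH lam)).map π = (UMat TOO (outerZ zE zH 0)).map π := by
  rw [UMat_map, UMat_map, map_outerZ zE zH π hl]

/-- `U_R(λ zE, zH) ≡ [U_R]_IR (mod λ)`. [cite: CvitanovicKinoshita1974b, §IV eq. (4.9)] -/
theorem map_UDet_outer (π : R →+* R') {lam : R} (hl : π lam = 0) :
    π (UDet TOO (outerZ zE zH lam)) = π (UDet TOO (outerZ zE zH 0)) := by
  rw [UDet, UDet, RingHom.map_det, RingHom.map_det, RingHom.mapMatrix_apply, RingHom.mapMatrix_apply, map_UMat_outer TOO zE zH π hl]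

/-- `M(λ²; λ zE, zH) ≡ M(0; 0, zH) (mod λ)` for the cofactor matrix of `U`. [cite: CvitanovicKinoshita1974b, §IV eq. (4.24)] -/
theorem mapMatrix_cofMat_ir (π : R →+* R') {lam : R} (hl : π lam = 0) :
    π.mapMatrix (cofMat TI TOS TOO zS (outerZ zE zH lam) (lam ^ 2)) = π.mapMatrix (cofMat TI TOS TOO zS (outerZ zE zH 0) 0) := by
  have hU : ∀ s t, π (UMat TOO (outerZ zE zH lam) s t) = π (UMat TOO (outerZ zE zH 0) s t) := fun s t => by
    have h := congrFun (congrFun (map_UMat_outer TOO zE zH π hl) s) t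
    simpa only [Matrix.map_apply] using h
  ext (s | s) (t | t)
  · simp [cofMat]
  · simp [cofMat]
  · simp [cofMat, hl]
  · simp [cofMat, hl, hU]

/-- `irU(λ) ≡ irU(0) (mod λ)`. [cite: CvitanovicKinoshita1974b, §IV eq. (4.24)] -/
theorem map_irU (π : R →+* R') {lam : R} (hl : π lam = 0) :
    π (irU TI TOS TOO zS zE zH lam) = π (irU TI TOS TOO zS zE zH 0) := by
  rw [irU, irU, RingHom.map_det, RingHom.map_det, mapMatrix_cofMat_ir TI TOS TOO zS zE zH π hl, zero_pow two_ne_zero]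

/-- `M̃(λ) ≡ M̃(0) (mod λ)`. [cite: CvitanovicKinoshita1974b, §IV eqs. (4.24), (4.30)] -/
theorem mapMatrix_irMat (π : R →+* R') {lam : R} (hl : π lam = 0) :
    π.mapMatrix (irMat TI TOS TOO zS zE zH lam) = π.mapMatrix (irMat TI TOS TOO zS zE zH 0) := by
  have hU : ∀ s t, π (UMat TOO (outerZ zE zH lam) s t) = π (UMat TOO (outerZ zE zH 0) s t) := fun s t => by
    have h := congrFun (congrFun (map_UMat_outer TOO zE zH π hl) s) t
    simpa only [Matrix.map_apply] using h
  ext (s | s) (t | t)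
  · simp [irMat]
  · simp [irMat, hl]
  · simp [irMat, hl]
  · simp [irMat, hl, hU]

omit [Fintype κI] [Fintype κO] [DecidableEq κI] [DecidableEq κO] in
/-- `w̃(λ) ≡ w̃(0) (mod λ)`. [cite: CvitanovicKinoshita1974b, §IV eq. (4.29)] -/
theorem map_irW (π : R →+* R') {lam : R} (hl : π lam = 0) :
    π ∘ irW TI TOS TOO zS zE χS χE lam = π ∘ irW TI TOS TOO zS zE χS χE 0 := by
  funext s
  rcases s with s | s
  · simp [irW]
  · simp [irW, hl]

/-- `irG(λ) ≡ irG(0) (mod λ)`. [cite: CvitanovicKinoshita1974b, §IV eq. (4.30)] -/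
theorem map_irG (π : R →+* R') {lam : R} (hl : π lam = 0) :
    π (irG TI TOS TOO zS zE zH χS χE lam) = π (irG TI TOS TOO zS zE zH χS χE 0) := by
  have hmv : ∀ (l : R), π ∘ ((irMat TI TOS TOO zS zE zH l).adjugate *ᵥ irW TI TOS TOO zS zE χS χE l) =
      (π.mapMatrix (irMat TI TOS TOO zS zE zH l)).adjugate *ᵥ (π ∘ irW TI TOS TOO zS zE χS χE l) := by
    intro l
    funext i
    rw [Function.comp_apply, RingHom.map_mulVec, ← RingHom.mapMatrix_apply, RingHom.map_adjugate]
  rw [irG, irG, RingHom.map_dotProduct, RingHom.map_dotProduct, hmv, hmv, map_irW TI TOS TOO zS zE χS χE π hl,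
    mapMatrix_irMat TI TOS TOO zS zE zH π hl]

/-- `QGR(λ) ≡ QGR(0) (mod λ)` for the reduced diagram's quadratic form along the ray. [cite: CvitanovicKinoshita1974b, §IV A eq. (4.17)] -/
theorem map_outerG (π : R →+* R') {lam : R} (hl : π lam = 0) :
    π (outerG TOO zE zH χE lam) = π (outerG TOO zE zH χE 0) := by
  have hmv : ∀ (l : R), π ∘ ((UMat TOO (outerZ zE zH l)).adjugate *ᵥ softW TOO zE χE) =
      ((UMat TOO (outerZ zE zH l)).map π).adjugate *ᵥ (π ∘ softW TOO zE χE) := by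
    intro l
    funext i
    rw [Function.comp_apply, RingHom.map_mulVec, ← RingHom.mapMatrix_apply, RingHom.map_adjugate, RingHom.mapMatrix_apply]
  rw [outerG, outerG, RingHom.map_dotProduct, RingHom.map_dotProduct, hmv, hmv, map_UMat_outer TOO zE zH π hl]

end ModLam

/-! ## The remainders along the IR ray -/

section Remainders

variable {R : Type*} [CommRing R]
variable {κI κO μS μE μH : Type*} [Fintype κI] [Fintype κO] [Fintype μS] [Fintype μE] [Fintype μH] [DecidableEq κI] [DecidableEq κO]
variable (TI : Matrix κI μS ℤ) (TOS : Matrix κO μS ℤ) (TOO : Matrix κO (μE ⊕ μH) ℤ)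
  (zS : μS → R) (zE : μE → R) (zH : μH → R) (χS : μS → R) (χE : μE → R)

/-- An element killed by the quotient map modulo `λ` is a multiple of `λ`. [folklore] -/
private theorem dvd_of_mk_eq_zero {lam x : R} (h : Ideal.Quotient.mk (Ideal.span {lam}) x = 0) : lam ∣ x := by
  obtain ⟨a, ha⟩ := Ideal.mem_span_singleton'.1 (Ideal.Quotient.eq_zero_iff_mem.1 h)
  exact ⟨a, by rw [← ha, mul_comm]⟩

/-- `λ ≡ 0` in `R ⧸ (λ)`. [folklore] -/
private theorem mk_self_eq_zero (lam : R) : Ideal.Quotient.mk (Ideal.span {lam}) lam = 0 :=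
  Ideal.Quotient.eq_zero_iff_mem.2 (Ideal.mem_span_singleton_self lam)

/-- `U_G − U_S U_R` along the IR ray, factorised: `= λ^{2n_S} · (irU(λ) − U_S · U_R(λ zE, zH))`.
[cite: CvitanovicKinoshita1974b, §IV eq. (4.24); AoyamaHayakawaKinoshitaNio2008 §3 («U → U_S U_R»)] -/
theorem irRU_eq (lam : R) :
    UDet (adaptedT TI TOS TOO) (irZ zS zE zH lam) - UDet TI (fun b => lam ^ 2 * zS b) * UDet TOO (outerZ zE zH lam) =
      lam ^ (2 * Fintype.card κI) * (irU TI TOS TOO zS zE zH lam - UDet TI zS * UDet TOO (outerZ zE zH lam)) := by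
  rw [UDet_ir, UDet_smul, ← pow_mul]
  ring

/-- **`U − U_S U_R = O(δ^{2 n_S + 1})` along the IR limit**: the I-operation's merged `U` is the lowest-power term, the remainder is divisible by
one more power of the IR scale: `λ^{2n_S+1} ∣ U_G(λ² zS, λ zE, zH) − U_S(λ² zS)·U_R(λ zE, zH)`.
[cite: AoyamaHayakawaKinoshitaNio2008, §3 (I-operation: «keep only terms with lowest power of ε and δ in U … U → U_S U_R»); CvitanovicKinoshita1974b §IV eq. (4.24)] -/
theorem irRU_dvd (lam : R) :
    lam ^ (2 * Fintype.card κI + 1) ∣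
      UDet (adaptedT TI TOS TOO) (irZ zS zE zH lam) - UDet TI (fun b => lam ^ 2 * zS b) * UDet TOO (outerZ zE zH lam) := by
  have hq : lam ∣ irU TI TOS TOO zS zE zH lam - UDet TI zS * UDet TOO (outerZ zE zH lam) := by
    refine dvd_of_mk_eq_zero ?_
    rw [map_sub, map_mul, map_irU TI TOS TOO zS zE zH _ (mk_self_eq_zero lam), map_UDet_outer TOO zE zH _ (mk_self_eq_zero lam), irU_zero,
      map_mul, sub_self]
  rw [irRU_eq, pow_succ]
  exact mul_dvd_mul_left _ hq

/-- **The quadratic-form numerator along the IR ray**: `irGNUM := G_G·U_S U_R − G_S·U_G U_R − G_R·U_G U_S` with `G = wᵀ adj(U_st) w` (on shell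
`U·V = m² G`), every factor evaluated at the IR point `(λ² zS, λ zE, zH)` of `M_G`'s own domain. [cite: AoyamaHayakawaKinoshitaNio2008, §3 («V → V_S + V_R»)] -/
def irGNUM (lam : R) : R :=
  GQuad (adaptedT TI TOS TOO) (irZ zS zE zH lam) (irχ χS χE) * (UDet TI (fun b => lam ^ 2 * zS b) * UDet TOO (outerZ zE zH lam))
    - GQuad TI (fun b => lam ^ 2 * zS b) χS * (UDet (adaptedT TI TOS TOO) (irZ zS zE zH lam) * UDet TOO (outerZ zE zH lam))
    - GQuad TOO (outerZ zE zH lam) (outerχ χE) * (UDet (adaptedT TI TOS TOO) (irZ zS zE zH lam) * UDet TI (fun b => lam ^ 2 * zS b))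

/-- The cofactor of `irGNUM`: `irGNUM(λ) = λ^{4n_S+2} · irgCof(λ)`. [cite: CvitanovicKinoshita1974b, §IV eqs. (4.24), (4.30)] -/
def irgCof (lam : R) : R :=
  irG TI TOS TOO zS zE zH χS χE lam * (UDet TI zS * UDet TOO (outerZ zE zH lam))
    - GQuad TI zS χS * (irU TI TOS TOO zS zE zH lam * UDet TOO (outerZ zE zH lam))
    - outerG TOO zE zH χE lam * (irU TI TOS TOO zS zE zH lam * UDet TI zS)

/-- `irGNUM(λ) = λ^{4n_S+2} · irgCof(λ)` (`n_S ≥ 1`): the orders `G_G = λ^{2n_S+2} irG`, `U_G = λ^{2n_S} irU`, `U_S(λ² z) = λ^{2n_S} U_S`,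
`G_S(λ² z) = λ^{2n_S+2} G_S`, `G_R(λ zE, zH) = λ² QGR(λ)`. [cite: CvitanovicKinoshita1974b, §IV eqs. (4.17), (4.24), (4.30)] -/
theorem irGNUM_eq (hI : 0 < Fintype.card κI) (lam : R) :
    irGNUM TI TOS TOO zS zE zH χS χE lam = lam ^ (4 * Fintype.card κI + 2) * irgCof TI TOS TOO zS zE zH χS χE lam := by
  have h4 : lam ^ (4 * Fintype.card κI + 2) = lam ^ (2 * Fintype.card κI + 2) * lam ^ (2 * Fintype.card κI) := by
    rw [← pow_add]; congr 1; omega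
  rw [irGNUM, irgCof, GQuad_ir, UDet_ir, UDet_smul, GQuad_smul hI, GQuad_outer, ← pow_mul, ← pow_mul, h4]
  have h2 : lam ^ (2 * (Fintype.card κI + 1)) = lam ^ (2 * Fintype.card κI + 2) := by congr 1
  rw [h2]
  ring

/-- **The leading coefficient cancels: `irgCof(0) = 0`** — `irG(0) = [U_R]_IR G_S + U_S QGR(0)` ((4.30)) against `irU(0) = U_S [U_R]_IR` ((4.24)).
[cite: CvitanovicKinoshita1974b, §IV eqs. (4.24), (4.30)] -/
theorem irgCof_zero : irgCof TI TOS TOO zS zE zH χS χE 0 = 0 := by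
  rw [irgCof, irG_zero, irU_zero]
  ring

/-- `irgCof(λ) ≡ irgCof(0) = 0 (mod λ)`, hence `λ ∣ irgCof(λ)`. [cite: CvitanovicKinoshita1974b, §IV eqs. (4.24), (4.30)] -/
theorem lam_dvd_irgCof (lam : R) : lam ∣ irgCof TI TOS TOO zS zE zH χS χE lam := by
  have hl := mk_self_eq_zero lam
  refine dvd_of_mk_eq_zero ?_
  have h := congrArg (Ideal.Quotient.mk (Ideal.span {lam})) (irgCof_zero TI TOS TOO zS zE zH χS χE)
  rw [map_zero] at h
  rw [← h, irgCof, irgCof]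
  simp only [map_sub, map_mul, map_irG TI TOS TOO zS zE zH χS χE _ hl, map_irU TI TOS TOO zS zE zH _ hl, map_UDet_outer TOO zE zH _ hl,
    map_outerG TOO zE zH χE _ hl]

/-- **`G_G·U_S U_R − G_S·U_G U_R − G_R·U_G U_S = O(λ^{4n_S+3})`** (no mass-shell hypothesis; `n_S ≥ 1`): the quadratic forms of `G`, `S`, `R`
along the IR ray satisfy `λ^{4n_S+3} ∣ irGNUM(λ)`. [cite: CvitanovicKinoshita1974b, §IV eqs. (4.24), (4.30); AoyamaHayakawaKinoshitaNio2008 §3] -/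
theorem irGNUM_dvd (hI : 0 < Fintype.card κI) (lam : R) :
    lam ^ (4 * Fintype.card κI + 3) ∣ irGNUM TI TOS TOO zS zE zH χS χE lam := by
  rw [irGNUM_eq TI TOS TOO zS zE zH χS χE hI, pow_succ]
  exact mul_dvd_mul_left _ (lam_dvd_irgCof TI TOS TOO zS zE zH χS χE lam)

/-- **The IR «Δ-numerator»** `irDNUM := (UV)_G·U_S U_R − (UV)_S·U_G U_R − (UV)_R·U_G U_S`, the numerator of `V_G − V_S − V_R` over the common
denominator `U_G U_S U_R`, every factor at the IR point of `M_G`'s own domain (masses `msq`, the same `p²` for `G`, `S`, `R`; `S` with the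
restricted masses and incidence `χS`, `R` with `outerχ χE`). [cite: AoyamaHayakawaKinoshitaNio2008, §3 (I-operation «V → V_S + V_R»)] -/
def irDNUM (msq : μS ⊕ (μE ⊕ μH) → R) (psq lam : R) : R :=
  VNum (adaptedT TI TOS TOO) (irZ zS zE zH lam) msq (irχ χS χE) psq * (UDet TI (fun b => lam ^ 2 * zS b) * UDet TOO (outerZ zE zH lam))
    - VNum TI (fun b => lam ^ 2 * zS b) (fun b => msq (Sum.inl b)) χS psq *
        (UDet (adaptedT TI TOS TOO) (irZ zS zE zH lam) * UDet TOO (outerZ zE zH lam))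
    - VNum TOO (outerZ zE zH lam) (fun c => msq (Sum.inr c)) (outerχ χE) psq *
        (UDet (adaptedT TI TOS TOO) (irZ zS zE zH lam) * UDet TI (fun b => lam ^ 2 * zS b))

/-- On the mass shell (`m_i² = m² χ_i²`, `p² = m²`) `irDNUM = m² · irGNUM`. [cite: CvitanovicKinoshita1974b, §IV A (remark after eq. (4.16))] -/
theorem irDNUM_onShell (msq : μS ⊕ (μE ⊕ μH) → R) (m2 lam : R) (h : ∀ c, msq c = m2 * (irχ χS χE c * irχ χS χE c)) :
    irDNUM TI TOS TOO zS zE zH χS χE msq m2 lam = m2 * irGNUM TI TOS TOO zS zE zH χS χE lam := by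
  have hS : ∀ b, (fun b => msq (Sum.inl b)) b = m2 * (χS b * χS b) := fun b => by simpa [irχ] using h (Sum.inl b)
  have hO : ∀ c, (fun c => msq (Sum.inr c)) c = m2 * (outerχ χE c * outerχ χE c) := fun c => by simpa [irχ] using h (Sum.inr c)
  rw [irDNUM, irGNUM, VNum_onShell _ _ _ _ _ h, VNum_onShell _ _ _ _ _ hS, VNum_onShell _ _ _ _ _ hO]
  ring

/-- **`V − V_S − V_R = O(δ³)` against `V = O(δ²)`, on the mass shell**: `λ^{4n_S+3} ∣ (UV)_G·U_S U_R − (UV)_S·U_G U_R − (UV)_R·U_G U_S` along the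
IR limit (each term being `O(λ^{4n_S+2})`) — the I-operation's merged `V_S + V_R` is the lowest-power term of `V` on `M_G`'s domain, the remainder
one order higher. [cite: AoyamaHayakawaKinoshitaNio2008, §3 (I-operation: «In the limit (irlimit) keep only terms with lowest power of ε and δ … V → V_S + V_R»); CvitanovicKinoshita1974b §IV eq. (4.30)] -/
theorem irDNUM_dvd (hI : 0 < Fintype.card κI) (msq : μS ⊕ (μE ⊕ μH) → R) (m2 lam : R)
    (h : ∀ c, msq c = m2 * (irχ χS χE c * irχ χS χE c)) :
    lam ^ (4 * Fintype.card κI + 3) ∣ irDNUM TI TOS TOO zS zE zH χS χE msq m2 lam := by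
  rw [irDNUM_onShell TI TOS TOO zS zE zH χS χE msq m2 lam h]
  exact Dvd.dvd.mul_left (irGNUM_dvd TI TOS TOO zS zE zH χS χE hI lam) m2

end Remainders

end Literature.MathematicalPhysics.QuantumFieldTheory.AoyamaHayakawaKinoshitaNio2008
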